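import Literature.NumberTheory.EllipticCurves.KellerYin2024.AnomalousAnticyclotomicMainConjecture
import Literature.NumberTheory.EllipticCurves.Isogeny
import Literature.NumberTheory.EllipticCurves.SupersingularIrreducibleProofs
import HarnessLib

/-!
# Crux `MazurMCOnX1RankZero` (item stmt-BirchSwinnertonDyer-19035), line `interlude_with_torsion`:
# stub `stub_classValue` (K2 ∘ `stub_plusLineValue`) — the Greenberg characteristic series on the
# CYCLOTOMIC line has the BDP value at EVERY member of the isogeny class of the good lattice

Cell `bsd-eis` (host `run/shared/lean/pub/bsd-eis/`), lead `bsd-line-x1-p2` (g3); `--supports`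
stmt-BirchSwinnertonDyer-19035; theorems only. No summit statement (BSD, Mazur's main conjecture, IMC2)
is proved here (imports are route-independent: no `Theses` module in the cone). Skeleton v5 of `Cruxes/MazurMCOnX1RankZero/Lines/interlude_with_torsion.lean` splits the
birth stub `stub_cycToOrd` (K2 ⊕ K3 ⊕ Step 3) into `stub_isogenyGr` (K2 = isogeny invariance of
`char 𝔛_Gr(·/K_∞⁺)` — Perrin-Riou 1989's μ-variation theorem gives `0` by her formula, but her printed
statement is for ONE filtration index `t` at all `v ∣ p`, so for the mixed Greenberg structure (relaxed
`v`, strict `v̄`) it is her place-by-place PROOF that applies, not her statement: reviewer of p617858;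
hence an OPEN stub of the line, stated in the skeleton as the currency `IsogenyInvarianceGrCyc`), THIS
plumbing stub, and `stub_stepsTwoThree` (CGS 2025 §5 Steps 2–3 on Wüthrich's lattice `E_•`, behind the
displayed PRE rider).

THE STUB (registered signature, v5): `stub_classValue (hK2 : «IsogenyInvarianceGrCyc») :
«CycLineBDPValueGoodLattice» → «CycLineValueClass»` with the three line currencies UNFOLDED: from the value at the good lattice `E_g`
(`𝔛_Gr(E_g/K_∞⁺)` torsion, generator `𝓕`, `𝓕(0) ≠ 0`, `𝓕(0) = u · c_{E_g}⁻² (1 − a_p p⁻¹ + p⁻¹)²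
log_{ω_{E_g}}(P_K)²`) to the SAME statement for `𝔛_Gr(W'/K_∞⁺)` for every `W'` rationally isogenous to
`E_g` — in particular for `E_•` — with the SAME generator `𝓕`, because by `hK2` the two characteristic
ideals of `Λ = ℤ_p⟦T⟧` coincide (Perrin-Riou's 1989 μ-formula reads `m − m − 0 = 0` here; K2 is the
line's open stub `stub_isogenyGr`). CONDITIONAL on `hK2` (open stub of the line); plumbing only.
[cite: PerrinRiou1989ASPM, Théorème (p. 349) (method)] [cite: CastellaGrossiSkinner2025, §5 Step 3 and the remark after Prop. 3.2.3 (l. 1241–1243)]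
-/

set_option linter.dupNamespace false
set_option autoImplicit false

noncomputable section

open scoped Classical

open WeierstrassCurve NumberField IsDedekindDomain Field
  Literature.NumberTheory.EllipticCurves Literature.NumberTheory.EllipticCurves.ModularForms
  Literature.NumberTheory.EllipticCurves.Rank1Residual
  Literature.NumberTheory.EllipticCurves.CyclotomicZp Literature.NumberTheory.EllipticCurves.Castella2018
  Literature.NumberTheory.QuadraticFields

namespace Summit.BirchSwinnertonDyer.BirchSwinnertonDyer.Theorems.InterludeWithTorsion

/-- **Stub `stub_classValue` of line `interlude_with_torsion` (crux `MazurMCOnX1RankZero`, item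
stmt-BirchSwinnertonDyer-19035), REGISTERED SIGNATURE (skeleton v5): K2 ∘ (value at the good lattice) ⟹
the value at EVERY member of the class.** Hypothesis `hK2` = the line's K2 currency
`IsogenyInvarianceGrCyc` VERBATIM (along a rational isogeny the characteristic ideal of `𝔛_Gr(·/K_∞⁺)`
does not change; Perrin-Riou 1989's method, her printed formula giving `0`). Premise = the line currency
`CycLineBDPValueGoodLattice` VERBATIM (unfolded); conclusion = the v5 currency `CycLineValueClass` VERBATIM
(unfolded): for the good lattice `W = E_g` at an anomalous Eisenstein `p > 2`, its Heegner field data and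
the cyclotomic pair `(κ, γ)`, and for EVERY `W'` with `IsIsogenous W W'`: `𝔛_Gr(W'/K_∞⁺)` is torsion with
a generator `𝓕`, `𝓕(0) ≠ 0`, `𝓕(0) = u · c_{E_g}⁻² (1 − a_p p⁻¹ + p⁻¹)² log_{ω_{E_g}}(P_K)²` (the value
is written in `E_g`'s data; it is the lattice-free BDP value `𝓛^BDP_p(f/K)(0)` up to a unit). Proof: the
generator of `char 𝔛_Gr(E_g/K_∞⁺)` given by the premise generates `char 𝔛_Gr(W'/K_∞⁺)` too (`hK2`;
`GoodOrd` from `Good` + `Red`; `v ∋ p` from the embedding `ι`).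
[cite: CastellaGrossiSkinner2025, §5 Step 3] [cite: PerrinRiou1989ASPM, Théorème (p. 349) (method)] -/
theorem stub_classValue
    (hK2 : ∀ (W₁ W₂ : WeierstrassCurve ℚ) [W₁.IsElliptic] [W₁.IsGloballyMinimal] [W₂.IsElliptic]
      [W₂.IsGloballyMinimal] (p : ℕ) [Fact p.Prime],
      2 < p → GoodOrd W₁ p → IsIsogenous W₁ W₂ →
      ∀ (K : Type) [Field K] [NumberField K], IsImaginaryQuadratic K →
        SatisfiesHeegnerHypothesis (W₁.conductorNorm ℤ) K → SatisfiesHeegnerHypothesis p K →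
      ∀ (v vbar : HeightOneSpectrum (𝓞 K)),
        ((p : ℕ) : 𝓞 K) ∈ v.asIdeal → ((p : ℕ) : 𝓞 K) ∈ vbar.asIdeal → vbar ≠ v →
      ∀ (κ : ZpExtension K p), κ.IsCyclotomic →
      ∀ (γ : absoluteGaloisGroup K) [Fact (κ.IsTopGenerator γ)],
        Module.IsTorsion (IwasawaAlgebra p) (AcSelmer.XAc (W₁.baseChange K) p κ vbar ∅ γ) →
        Module.IsTorsion (IwasawaAlgebra p) (AcSelmer.XAc (W₂.baseChange K) p κ vbar ∅ γ) ∧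
        AcSelmer.XAc.charIdeal (W₁.baseChange K) p κ vbar ∅ γ =
          AcSelmer.XAc.charIdeal (W₂.baseChange K) p κ vbar ∅ γ) :
    (
    ∀ (W : WeierstrassCurve ℚ) [W.IsElliptic] [W.IsGloballyMinimal] (p : ℕ) [Fact p.Prime],
      2 < p → Good W p → Red W p → Anom W p →
      (∀ Φ : AddSubgroup (geomTorsion W (p : ℤ)), IsRationalLine W p Φ → ¬ LineUnramifiedAt W p Φ) →
      ∀ (K : Type) [Field K] [NumberField K], IsImaginaryQuadratic K →
        SatisfiesHeegnerHypothesis (W.conductorNorm ℤ) K → SatisfiesHeegnerHypothesis p K →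
        Odd (NumberField.discr K) → NumberField.discr K ≠ -3 →
        (∀ Q : (W.baseChange K).toAffine.Point, p • Q = 0 → Q = 0) →
        (W.baseChange K).mordellWeilRank = 1 →
        Finite (AddCommGroup.primaryComponent (W.baseChange K).sha p) →
      ∀ (ι : K →+* ℚ_[p]) (v vbar : HeightOneSpectrum (𝓞 K)),
        (∀ x : 𝓞 K, x ∈ v.asIdeal ↔ ‖ι (x : K)‖ < 1) →
        ((p : ℕ) : 𝓞 K) ∈ vbar.asIdeal → vbar ≠ v →
      ∀ (κ : ZpExtension K p), κ.IsCyclotomic →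
      ∀ (γ : absoluteGaloisGroup K) [Fact (κ.IsTopGenerator γ)],
      ∀ (N : ℕ) [NeZero N] (Dt : ModularParametrizationData W N)
        (H : HeegnerDatum N (NumberField.discr K)) (ιC : K →+* ℂ) (P : (W.baseChange K).toAffine.Point),
        WeierstrassCurve.Affine.Point.map ιC.toRatAlgHom P = heegnerPointComplex Dt H →
        Module.IsTorsion (IwasawaAlgebra p) (AcSelmer.XAc (W.baseChange K) p κ vbar ∅ γ) ∧
        ∃ F : IwasawaAlgebra p,
          AcSelmer.XAc.charIdeal (W.baseChange K) p κ vbar ∅ γ = Ideal.span {F} ∧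
          PowerSeries.constantCoeff F ≠ 0 ∧
          ∃ u : ℤ_[p]ˣ,
            ((PowerSeries.constantCoeff F : ℤ_[p]) : ℚ_[p]) =
              ((u : ℤ_[p]) : ℚ_[p]) * ((Dt.c : ℚ_[p])⁻¹) ^ 2 *
                (1 - (W.frobeniusTrace p : ℚ_[p]) * (p : ℚ_[p])⁻¹ + (p : ℚ_[p])⁻¹) ^ 2 *
                ((W.baseChange ℚ_[p]).padicLogPoint (formalIndex W p • padicPointOf W p ι P) /
                  (formalIndex W p : ℚ_[p])) ^ 2) →
    ∀ (W : WeierstrassCurve ℚ) [W.IsElliptic] [W.IsGloballyMinimal] (p : ℕ) [Fact p.Prime],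
      2 < p → Good W p → Red W p → Anom W p →
      (∀ Φ : AddSubgroup (geomTorsion W (p : ℤ)), IsRationalLine W p Φ → ¬ LineUnramifiedAt W p Φ) →
      ∀ (W' : WeierstrassCurve ℚ) [W'.IsElliptic] [W'.IsGloballyMinimal], IsIsogenous W W' →
      ∀ (K : Type) [Field K] [NumberField K], IsImaginaryQuadratic K →
        SatisfiesHeegnerHypothesis (W.conductorNorm ℤ) K → SatisfiesHeegnerHypothesis p K →
        Odd (NumberField.discr K) → NumberField.discr K ≠ -3 →
        (∀ Q : (W.baseChange K).toAffine.Point, p • Q = 0 → Q = 0) →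
        (W.baseChange K).mordellWeilRank = 1 →
        Finite (AddCommGroup.primaryComponent (W.baseChange K).sha p) →
      ∀ (ι : K →+* ℚ_[p]) (v vbar : HeightOneSpectrum (𝓞 K)),
        (∀ x : 𝓞 K, x ∈ v.asIdeal ↔ ‖ι (x : K)‖ < 1) →
        ((p : ℕ) : 𝓞 K) ∈ vbar.asIdeal → vbar ≠ v →
      ∀ (κ : ZpExtension K p), κ.IsCyclotomic →
      ∀ (γ : absoluteGaloisGroup K) [Fact (κ.IsTopGenerator γ)],
      ∀ (N : ℕ) [NeZero N] (Dt : ModularParametrizationData W N)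
        (H : HeegnerDatum N (NumberField.discr K)) (ιC : K →+* ℂ) (P : (W.baseChange K).toAffine.Point),
        WeierstrassCurve.Affine.Point.map ιC.toRatAlgHom P = heegnerPointComplex Dt H →
        Module.IsTorsion (IwasawaAlgebra p) (AcSelmer.XAc (W'.baseChange K) p κ vbar ∅ γ) ∧
        ∃ F : IwasawaAlgebra p,
          AcSelmer.XAc.charIdeal (W'.baseChange K) p κ vbar ∅ γ = Ideal.span {F} ∧
          PowerSeries.constantCoeff F ≠ 0 ∧
          ∃ u : ℤ_[p]ˣ,
            ((PowerSeries.constantCoeff F : ℤ_[p]) : ℚ_[p]) =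
              ((u : ℤ_[p]) : ℚ_[p]) * ((Dt.c : ℚ_[p])⁻¹) ^ 2 *
                (1 - (W.frobeniusTrace p : ℚ_[p]) * (p : ℚ_[p])⁻¹ + (p : ℚ_[p])⁻¹) ^ 2 *
                ((W.baseChange ℚ_[p]).padicLogPoint (formalIndex W p • padicPointOf W p ι P) /
                  (formalIndex W p : ℚ_[p])) ^ 2 := by
  intro hval W _ _ p _ hp hgood hred hanom hGL W' _ _ hiso K _ _ hK hHN hHp hodd h3 hEK hrank hfin ι v vbar hv
    hvbar hne κ hκ γ _ N _ Dt H ιC P hP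
  obtain ⟨htors, F, hF, hF0, u, hu⟩ := hval W p hp hgood hred hanom hGL K hK hHN hHp hodd h3 hEK hrank hfin ι
    v vbar hv hvbar hne κ hκ γ N Dt H ιC P hP
  have hvp : ((p : ℕ) : 𝓞 K) ∈ v.asIdeal := by
    rw [hv]
    simp only [map_natCast]
    exact Padic.norm_p_lt_one
  obtain ⟨htors', hchar⟩ := hK2 W W' p hp (goodOrd_of_red_of_good W p hp hgood hred) hiso K hK hHN hHp v
    vbar hvp hvbar hne κ hκ γ htors
  exact ⟨htors', F, hchar ▸ hF, hF0, u, hu⟩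

end Summit.BirchSwinnertonDyer.BirchSwinnertonDyer.Theorems.InterludeWithTorsion

end
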